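import Summits.QuantumFields.BalabanUV.Gaps.D1Residue
import Literature.MathematicalPhysics.QuantumFieldTheory.Balaban1983to89.T4ContinuumYM4Torus

/-!
# `BalabanUV.Gaps.D1ResidueComposite` — cell `pub-balaban-gaps` (YM blitz Y1), track G1, seat g1-p1 (gen 2): **THE (D1) RESIDUE AT THE COMPOSITE-CONTOUR
# OBJECT CLASS, ACROSS TWO TELESCOPING PARTNERS, AND UP TO THE T⁴ HEADLINE** — the kernel faces of row-D1 owner an2's ruling R-D1-g42-4 (2026-08-22)

HONEST FRAMING (page 1, cell contract).  WHAT THIS IS: [folklore] triangle inequalities and compositions BY NAME over the cell's row-(D1) statement file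
`Gaps.D1Residue` (p340834), its two kernel files `Gaps.D1BinderEnds` (p339608) ∕ `Gaps.D1CumJcFree` (p340016), g1-p2's `Gaps.D4Residue` (p340123) and the print-faithful
torus theorem `T4ContinuumYM4Torus.continuumYM4_torus_of_endpointExistence_nonvacuous`.  WHAT THIS IS NOT: not a proof of (D1) or (D4); nothing of Bałaban's papers
asserted, valued or discharged ([B12] Theorem 2, CMP 109 (1987) p. 259, is printed WITHOUT proof; [B16] CMP 122 p. 355 «has not been published yet»); no table family,
no jet family and no split is asserted to satisfy anything; NOT `BetaPertH`, NOT the continuum limit on ℝ⁴, NOT a mass gap, NOT Clay.  HONEST DEPENDENCY (verbatim):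
continuum YM on T⁴ ⇐ BetaPertH ∧ nine spine estimates (0/9 proved); BetaPertH ⇐ (D1) ∧ (D4) ∧ CAP+tail; G-an2-4 gates asym, D1 and NE2/3/4.

WHY (the row moved under the seat on 2026-08-22).  Row-D1 owner an2's ruling R-D1-g42-4 (pub-balaban journal l.46750, 20:22:20Z) answers d1-p3's located question
«ONE `Jc` FOR BOTH ROADS?»: the composite jet family shared by road FP's `D1Tel` and road BF-x's `D1Rep` is the COMPOSITE-CONTOUR one-shot literal
`JcComp m := JsB12CombShSym (Lc := Lc^m) hLc.pow N (tabsComp m) (cΛ m) (cB m) 0` (tables `tabsComp` of Bałaban's `m`-fold averaging = the `m`-fold composition of the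
`Lc`-step contour systems — to be named `JcOfTabs … tabsComp` by the owners; `tabsComp` is a table-supplier object, Q-an2-g42-3), NOT in general the direct-contour
literal `JcOf` (an2 p339189: `tabs m := symTablesAn1S2 3 (Lc^m) (cΛ m)`) beyond depth `1`; an exact-ℚ DETECTOR (Engine C ∕ ttrl3, authorised there) decides whether the
two table families agree («(a) equal ∕ (c) differ») class by class.  The cell's statement file pinned the missing lemma at `JcOf`
(`D1Residue.d1Drift_record_iff_oneShotLaw_JcOf`).  THIS FILE records what the residue sees of the ruling — nothing but BOUNDEDNESS OF ONE DIFFERENCE OF READ-OUTS —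
and restates the pinned ENDs for the whole composite-contour class, WITHOUT defining `JcOfTabs` ∕ `tabsComp` (the owners' names) and without asserting anything
of either family:
* §1 TWO TELESCOPING PARTNERS.  Two composite families that BOTH telescope onto the same step family in `O(1)` currency (`ReadoutBdd`) have one-shot (1.22)
  read-outs within `O(1)` of each other and EQUIVALENT one-shot laws (`oneShotLaw_iff_of_readoutBdd_pair`); (RB) passes from one family to another exactly along
  a bounded difference of read-outs (`readoutBdd_of_readoutBdd_of_gap_bdd`); contrapositively, two families whose read-outs separate WITHOUT BOUND are not both
  telescoping partners, nor both lawful (`not_readoutBdd_pair_of_gap_unbounded`, `not_oneShotLaw_pair_of_gap_unbounded`).  So the detector's «(c) differ» verdict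
  moves NOTHING at residue grade unless the difference of the two one-shot second moments is unbounded in `m`, in which case AT MOST ONE of `JcOf` ∕ `JcComp`
  carries (RB) — and the roads must meet at that one.
* §2 THE PINNED ENDs AT THE COMPOSITE-CONTOUR CLASS: §4 of `D1Residue` restated for `m ↦ JsB12CombShSym (Lc := Lc^m) hLc.pow N (tabs m) (cΛ' m) (cB' m) 0` over ANY
  scale-indexed table family `tabs : ∀ m, SymTables 3 (Lc^m)`, with `JcOf` the member `tabs m := symTablesAn1S2 3 (Lc^m) (cΛ' m)` by `rfl`; hence the row's
  «next attempt» signature `OneShotLaw Lc (fun m => JsB12CombShSym (Lc := Lc^m) hLc.pow N (tabsComp m) (cΛ' m) (cB' m) 0) Nc μ ν` is a tree expression today for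
  whatever `tabsComp` the suppliers deliver, and `D1Tel` ∧ `OneShotLaw` at ONE such family ∧ the two printed [B5] statements ⟹ (D1) at the record literal.
* §3 UP TO THE T⁴ HEADLINE: the print-faithful torus theorem with its β-binder (B3 `BetaPertH`, B4 `BetaContH`, B6 positivity) REPLACED by the two named residues
  of this cell — `D1Residue.Residue` (row D1) and `RemainderResidue.AtSlope` (row D4, g1-p2) — plus continuity (C) on the same box: `continuumYM4Torus_of_residue_atSlope`
  (∀- and ∃-form); the same at ONE composite-contour family (`…_of_readoutBdd_oneShotLaw_tabs_atSlope`); and in the Jc-FREE currency `D1Cum` at the record literal under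
  the two printed [B5] statements (`…_of_d1Cum_atSlope_record`).  Binders displayed: B1 `hD`, B2 `hB`, B5 `hNE` (spine slot under endpoint existence, 0/9 proved),
  the one-loop split `Sβ` of `D.βfun` with the identification `hβ` of its one-loop coefficients with the typed step kernels' (1.22) second moments, and the residues.
  CAP + tail are NOT among the binders (the L1.2 path does not consume them — g1-plan-2 ROUTES-PLAN-2 §1, g1-p3 `Gaps.WeakestBetaCurrency`).

ABSOLUTE RULE (cell charter, verbatim): «No internally-minted statement may enter as a cited fact. Every hypothesis is either kernel-proved in this package or a
verbatim quotation of a PUBLISHED theorem with page reference.»  No `def`, no `def … : Prop`, nothing cited as mathematics, 0 sorry, axioms ⊆ the standard trio.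
Provenance: cell pub-balaban-gaps, seat g1-p1 gen 2, 2026-08-22; imports `Gaps.D1Residue` + `T4ContinuumYM4Torus` only; no existing file touched.
-/

noncomputable section

open Finset
open scoped BigOperators
open Literature.MathematicalPhysics.QuantumFieldTheory
open Literature.MathematicalPhysics.QuantumFieldTheory.Balaban1983to89
open Literature.MathematicalPhysics.QuantumFieldTheory.Balaban1983to89.Beta
open OneStepResolventKernel (JetData)
open OneStepKernelFamily (TbalOf TshotOf D1Tel D1Rep D1Drift)
open B12Beta (secondMoment)
open FlowStep FlowStepRuns DagBinding
open RemainderResidue (AtSlope)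
open VectorTailsLoc (fam kfam)
open VectorLegVolumeAdapter (MvE)
open T4Continuum (T4Family FiniteEpsData)
open T4ContinuumYM4Torus (ContinuumYM4Torus ContinuumYM4TorusE continuumYM4_torus_of_endpointExistence_nonvacuous)
open Summit.QuantumFields.BalabanUV.Beta.CombChartJointEnd (JsB12CombShSym)
open Summit.QuantumFields.BalabanUV.Beta.SymSecondOrderTablesAn1 (symTablesAn1S2)
open Summit.QuantumFields.BalabanUV.Beta.SymmetrisedStepJets (SymTables)
open Summit.QuantumFields.BalabanUV.Beta.CombOneShotJets (JcOf)
open Summit.QuantumFields.BalabanUV.Gaps.D1Residue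

namespace Summit.QuantumFields.BalabanUV.Gaps.D1ResidueComposite

variable {Lc : ℕ} [NeZero Lc] {L : Type*}

/-! ## §1 Two telescoping partners: the one-shot law does not depend on WHICH partner, up to `O(1)` -/

/-- [folklore] **TWO TELESCOPING PARTNERS HAVE ONE-SHOT READ-OUTS WITHIN `O(1)` OF EACH OTHER**: `ReadoutBdd Lc Js Jc μ ν ∧ ReadoutBdd Lc Js Jc' μ ν ⟹
∃ U, ∀ m ≥ 1, |secondMoment (TshotOf Lc Jc m) μ ν − secondMoment (TshotOf Lc Jc' m) μ ν| ≤ U`. -/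
theorem oneShot_gap_bdd_of_readoutBdd_pair (Js : ℕ → JetData 3 Lc) (Jc Jc' : ∀ m : ℕ, JetData 3 (Lc ^ m)) {μ ν : Fin 4}
    (h : ReadoutBdd Lc Js Jc μ ν) (h' : ReadoutBdd Lc Js Jc' μ ν) :
    ∃ U : ℝ, ∀ m : ℕ, 1 ≤ m → |secondMoment (TshotOf Lc Jc m) μ ν - secondMoment (TshotOf Lc Jc' m) μ ν| ≤ U := by
  obtain ⟨U₁, h₁⟩ := h
  obtain ⟨U₂, h₂⟩ := h'
  refine ⟨U₂ + U₁, fun m hm => ?_⟩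
  have e : secondMoment (TshotOf Lc Jc m) μ ν - secondMoment (TshotOf Lc Jc' m) μ ν =
      (∑ j ∈ range m, secondMoment (TbalOf Lc Js j) μ ν - secondMoment (TshotOf Lc Jc' m) μ ν) -
        (∑ j ∈ range m, secondMoment (TbalOf Lc Js j) μ ν - secondMoment (TshotOf Lc Jc m) μ ν) := by ring
  rw [e]
  exact (abs_sub _ _).trans (add_le_add (h₂ m hm) (h₁ m hm))

/-- [folklore] **TWO FAMILIES OBEYING THE ONE-SHOT LAW HAVE ONE-SHOT READ-OUTS WITHIN `O(1)` OF EACH OTHER** (same slope, two defects). -/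
theorem oneShot_gap_bdd_of_oneShotLaw_pair (Jc Jc' : ∀ m : ℕ, JetData 3 (Lc ^ m)) {N : ℝ} {μ ν : Fin 4}
    (h : OneShotLaw Lc Jc N μ ν) (h' : OneShotLaw Lc Jc' N μ ν) :
    ∃ U : ℝ, ∀ m : ℕ, 1 ≤ m → |secondMoment (TshotOf Lc Jc m) μ ν - secondMoment (TshotOf Lc Jc' m) μ ν| ≤ U := by
  obtain ⟨U₁, h₁⟩ := h
  obtain ⟨U₂, h₂⟩ := h'
  refine ⟨U₁ + U₂, fun m hm => ?_⟩
  have e : secondMoment (TshotOf Lc Jc m) μ ν - secondMoment (TshotOf Lc Jc' m) μ ν =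
      (secondMoment (TshotOf Lc Jc m) μ ν - B12Normalization.stepBal N Lc * m) -
        (secondMoment (TshotOf Lc Jc' m) μ ν - B12Normalization.stepBal N Lc * m) := by ring
  rw [e]
  exact (abs_sub _ _).trans (add_le_add (h₁ m hm) (h₂ m hm))

/-- [folklore] **THE ONE-SHOT LAW IS PARTNER-INDEPENDENT ACROSS TELESCOPING PARTNERS**: if `Jc` and `Jc'` both telescope onto the step family `Js` in `O(1)` currency,
`OneShotLaw Lc Jc N μ ν ⟺ OneShotLaw Lc Jc' N μ ν` (both are `⟺ D1Drift Lc Js N μ ν`, `D1Residue.d1Drift_iff_oneShotLaw_of_readoutBdd`). -/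
theorem oneShotLaw_iff_of_readoutBdd_pair (Js : ℕ → JetData 3 Lc) (Jc Jc' : ∀ m : ℕ, JetData 3 (Lc ^ m)) {N : ℝ} {μ ν : Fin 4}
    (h : ReadoutBdd Lc Js Jc μ ν) (h' : ReadoutBdd Lc Js Jc' μ ν) : OneShotLaw Lc Jc N μ ν ↔ OneShotLaw Lc Jc' N μ ν :=
  (d1Drift_iff_oneShotLaw_of_readoutBdd Js Jc h).symm.trans (d1Drift_iff_oneShotLaw_of_readoutBdd Js Jc' h')

/-- [folklore] **TRANSFER OF (RB) ALONG A BOUNDED GAP**: if `Jc` telescopes onto `Js` and the read-outs of `Jc'` stay within `O(1)` of those of `Jc`, then `Jc'` telescopes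
too — (RB) passes between composite families exactly along bounded differences of one-shot second moments. -/
theorem readoutBdd_of_readoutBdd_of_gap_bdd (Js : ℕ → JetData 3 Lc) (Jc Jc' : ∀ m : ℕ, JetData 3 (Lc ^ m)) {μ ν : Fin 4}
    (h : ReadoutBdd Lc Js Jc μ ν)
    (hgap : ∃ U : ℝ, ∀ m : ℕ, 1 ≤ m → |secondMoment (TshotOf Lc Jc m) μ ν - secondMoment (TshotOf Lc Jc' m) μ ν| ≤ U) :
    ReadoutBdd Lc Js Jc' μ ν := by
  obtain ⟨U₁, h₁⟩ := h
  obtain ⟨U₂, h₂⟩ := hgap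
  refine ⟨U₁ + U₂, fun m hm => ?_⟩
  have e : ∑ j ∈ range m, secondMoment (TbalOf Lc Js j) μ ν - secondMoment (TshotOf Lc Jc' m) μ ν =
      (∑ j ∈ range m, secondMoment (TbalOf Lc Js j) μ ν - secondMoment (TshotOf Lc Jc m) μ ν) +
        (secondMoment (TshotOf Lc Jc m) μ ν - secondMoment (TshotOf Lc Jc' m) μ ν) := by ring
  rw [e]
  exact (abs_add_le _ _).trans (add_le_add (h₁ m hm) (h₂ m hm))

/-- [folklore] **TRANSFER OF THE ONE-SHOT LAW ALONG A BOUNDED GAP** (no step family involved): `OneShotLaw Lc Jc N μ ν` and a bounded difference of read-outs give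
`OneShotLaw Lc Jc' N μ ν`. -/
theorem oneShotLaw_of_oneShotLaw_of_gap_bdd (Jc Jc' : ∀ m : ℕ, JetData 3 (Lc ^ m)) {N : ℝ} {μ ν : Fin 4} (h : OneShotLaw Lc Jc N μ ν)
    (hgap : ∃ U : ℝ, ∀ m : ℕ, 1 ≤ m → |secondMoment (TshotOf Lc Jc m) μ ν - secondMoment (TshotOf Lc Jc' m) μ ν| ≤ U) :
    OneShotLaw Lc Jc' N μ ν := by
  obtain ⟨U₁, h₁⟩ := h
  obtain ⟨U₂, h₂⟩ := hgap
  refine ⟨U₁ + U₂, fun m hm => ?_⟩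
  have e : secondMoment (TshotOf Lc Jc' m) μ ν - B12Normalization.stepBal N Lc * m =
      (secondMoment (TshotOf Lc Jc m) μ ν - B12Normalization.stepBal N Lc * m) -
        (secondMoment (TshotOf Lc Jc m) μ ν - secondMoment (TshotOf Lc Jc' m) μ ν) := by ring
  rw [e]
  exact (abs_sub _ _).trans (add_le_add (h₁ m hm) (h₂ m hm))

/-- [folklore] **AT MOST ONE OF TWO SEPARATING FAMILIES TELESCOPES**: if the one-shot (1.22) read-outs of `Jc` and `Jc'` separate WITHOUT BOUND along `m ≥ 1`, then
`Jc` and `Jc'` are NOT both telescoping partners of the same step family (any `Js`).  The residue-level reading of the detector's «(c) differ» branch: a table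
difference matters for (RB) only through an unbounded difference of read-outs. -/
theorem not_readoutBdd_pair_of_gap_unbounded (Js : ℕ → JetData 3 Lc) (Jc Jc' : ∀ m : ℕ, JetData 3 (Lc ^ m)) {μ ν : Fin 4}
    (hgap : ∀ U : ℝ, ∃ m : ℕ, 1 ≤ m ∧ U < |secondMoment (TshotOf Lc Jc m) μ ν - secondMoment (TshotOf Lc Jc' m) μ ν|) :
    ¬ (ReadoutBdd Lc Js Jc μ ν ∧ ReadoutBdd Lc Js Jc' μ ν) := by
  rintro ⟨h, h'⟩
  obtain ⟨U, hU⟩ := oneShot_gap_bdd_of_readoutBdd_pair Js Jc Jc' h h'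
  obtain ⟨m, hm, hlt⟩ := hgap U
  exact (not_lt.mpr (hU m hm)) hlt

/-- [folklore] **… AND AT MOST ONE OF THEM OBEYS THE ONE-SHOT LAW** (same slope): separating read-outs exclude `OneShotLaw` for both. -/
theorem not_oneShotLaw_pair_of_gap_unbounded (Jc Jc' : ∀ m : ℕ, JetData 3 (Lc ^ m)) {N : ℝ} {μ ν : Fin 4}
    (hgap : ∀ U : ℝ, ∃ m : ℕ, 1 ≤ m ∧ U < |secondMoment (TshotOf Lc Jc m) μ ν - secondMoment (TshotOf Lc Jc' m) μ ν|) :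
    ¬ (OneShotLaw Lc Jc N μ ν ∧ OneShotLaw Lc Jc' N μ ν) := by
  rintro ⟨h, h'⟩
  obtain ⟨U, hU⟩ := oneShot_gap_bdd_of_oneShotLaw_pair Jc Jc' h h'
  obtain ⟨m, hm, hlt⟩ := hgap U
  exact (not_lt.mpr (hU m hm)) hlt

/-! ## §2 The pinned ENDs at the COMPOSITE-CONTOUR OBJECT CLASS (an2 R-D1-g42-4: `m ↦ JsB12CombShSym (Lc := Lc^m) hLc.pow N (tabs m) (cΛ' m) (cB' m) 0`)

The (III′) one-shot literal at blocking `Lc^m` over an ARBITRARY scale-indexed table family `tabs : ∀ m, SymTables 3 (Lc^m)` — the object class of an2's `JcOfTabs`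
(to be named by the row owner; NOT defined here) — and, inside it, `JcOf hLc N cΛ' cB'` as the member `tabs m := symTablesAn1S2 3 (Lc^m) (cΛ' m)` (`rfl`). -/

/-- [folklore] `JcOf` IS the direct-contour member of the class:
`JcOf hLc N cΛ' cB' = fun m => JsB12CombShSym (Lc := Lc^m) hLc.pow N (symTablesAn1S2 3 (Lc^m) (cΛ' m)) (cΛ' m) (cB' m) 0` (`rfl`; an2's `CombOneShotJets.JcOf_apply` pointwise). -/
theorem JcOf_eq_combShSym_tabs (hLc : Odd Lc) (N : ℕ) (cΛ' cB' : ℕ → ℝ) :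
    JcOf hLc N cΛ' cB' = fun m => JsB12CombShSym (Lc := Lc ^ m) hLc.pow N (symTablesAn1S2 3 (Lc ^ m) (cΛ' m)) (cΛ' m) (cB' m) 0 := rfl

/-- [folklore] **EXACTNESS AT THE LITERAL OF RECORD, COMPOSITE-CONTOUR CLASS**: for every scale-indexed table family `tabs` and lock functions `cΛ' cB'`, given (RB) of the
step jets of record onto `m ↦ JsB12CombShSym (Lc := Lc^m) hLc.pow N (tabs m) (cΛ' m) (cB' m) 0`, (D1) at the record literal ⟺ the one-shot law of that family. -/
theorem d1Drift_record_iff_oneShotLaw_tabs (hLc : Odd Lc) (N : ℕ) (cΛ cB : ℝ) (tabs : ∀ m : ℕ, SymTables 3 (Lc ^ m)) (cΛ' cB' : ℕ → ℝ) {Nc : ℝ} {μ ν : Fin 4}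
    (hbdd : ReadoutBdd Lc (JsB12CombShSym hLc N (symTablesAn1S2 3 Lc cΛ) cΛ cB)
      (fun m => JsB12CombShSym (Lc := Lc ^ m) hLc.pow N (tabs m) (cΛ' m) (cB' m) 0) μ ν) :
    D1Drift Lc (JsB12CombShSym hLc N (symTablesAn1S2 3 Lc cΛ) cΛ cB) Nc μ ν ↔
      OneShotLaw Lc (fun m => JsB12CombShSym (Lc := Lc ^ m) hLc.pow N (tabs m) (cΛ' m) (cB' m) 0) Nc μ ν :=
  d1Drift_iff_oneShotLaw_of_readoutBdd _ _ hbdd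

/-- [folklore] **… AND ITS UNCONDITIONAL HALF, COMPOSITE-CONTOUR CLASS**: (RB) onto the family ∧ its one-shot law ⟹ (D1) at the literal of record. -/
theorem d1Drift_record_of_readoutBdd_oneShotLaw_tabs (hLc : Odd Lc) (N : ℕ) (cΛ cB : ℝ) (tabs : ∀ m : ℕ, SymTables 3 (Lc ^ m)) (cΛ' cB' : ℕ → ℝ) {Nc : ℝ}
    {μ ν : Fin 4}
    (hbdd : ReadoutBdd Lc (JsB12CombShSym hLc N (symTablesAn1S2 3 Lc cΛ) cΛ cB)
      (fun m => JsB12CombShSym (Lc := Lc ^ m) hLc.pow N (tabs m) (cΛ' m) (cB' m) 0) μ ν)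
    (hlaw : OneShotLaw Lc (fun m => JsB12CombShSym (Lc := Lc ^ m) hLc.pow N (tabs m) (cΛ' m) (cB' m) 0) Nc μ ν) :
    D1Drift Lc (JsB12CombShSym hLc N (symTablesAn1S2 3 Lc cΛ) cΛ cB) Nc μ ν :=
  d1Drift_of_readoutBdd_oneShotLaw _ _ hbdd hlaw

/-- [folklore] **`D1Tel` ONTO THE FAMILY ∧ ITS ONE-SHOT LAW ∧ printed [B5] ⟹ (D1) AT THE PINNED JETS, COMPOSITE-CONTOUR CLASS** (locks instantiated;
`D1Residue.d1Drift_record_of_D1Tel_oneShotLaw` at `Jc := fun m => JsB12CombShSym (Lc := Lc^m) hLc.pow N (tabs m) (cΛ' m) (cB' m) 0`) — the shape in which road FP's `D1Tel`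
(an2 R-D1-g42-4: «the (C1) column factorisation then holds BY CONSTRUCTION for `JcComp`») and road BF-x's law meet ROOT M‴ at ONE composite-contour family. -/
theorem d1Drift_record_of_D1Tel_oneShotLaw_tabs (hLc : Odd Lc) (hL2 : 2 ≤ Lc) {N : ℕ} (hN : 2 ≤ N) (a : ℝ) (ha : 0 < a)
    (h12 : B5.Prop12Printed (fam (fun i : ℕ+ × ℕ => ((i.1 : ℕ+) : ℕ)) (fun i => i.1.pos) MvE a ha))
    (h126 : B5.Kernel126_127Printed (kfam (fun i : ℕ+ × ℕ => ((i.1 : ℕ+) : ℕ)) MvE))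
    {SL : Finset L} (hSL : SL.Nonempty) (k : L → Fin 4) {μ ν : Fin 4} (hμν : μ ≠ ν) {Nc : ℝ} (hNc : Nc ≠ 0)
    (tabs : ∀ m : ℕ, SymTables 3 (Lc ^ m)) (cΛ' cB' : ℕ → ℝ)
    (htel : D1Tel Lc (JsB12CombShSym hLc N (symTablesAn1S2 3 Lc (2 / (Lc : ℝ) ^ 4)) (2 / (Lc : ℝ) ^ 4) (-((Lc : ℝ) ^ 12 / 4)))
      (fun m => JsB12CombShSym (Lc := Lc ^ m) hLc.pow N (tabs m) (cΛ' m) (cB' m) 0))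
    (hlaw : OneShotLaw Lc (fun m => JsB12CombShSym (Lc := Lc ^ m) hLc.pow N (tabs m) (cΛ' m) (cB' m) 0) Nc μ ν) :
    D1Drift Lc (JsB12CombShSym hLc N (symTablesAn1S2 3 Lc (2 / (Lc : ℝ) ^ 4)) (2 / (Lc : ℝ) ^ 4) (-((Lc : ℝ) ^ 12 / 4))) Nc μ ν :=
  d1Drift_record_of_D1Tel_oneShotLaw hLc hL2 hN a ha h12 h126 hSL k hμν hNc _ htel hlaw

/-- [folklore] **`JcOf` VERSUS ANY COMPOSITE-CONTOUR FAMILY**: if BOTH the direct-contour literal `JcOf hLc N cΛ' cB'` and a family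
`m ↦ JsB12CombShSym (Lc := Lc^m) hLc.pow N (tabs m) (cΛ'' m) (cB'' m) 0` telescope onto the step jets of record in `O(1)` currency, their one-shot laws are EQUIVALENT (§1) —
the detector's verdict then moves nothing at residue grade; if their read-outs separate without bound, at most one of them telescopes (`not_readoutBdd_pair_of_gap_unbounded`). -/
theorem oneShotLaw_JcOf_iff_tabs_of_readoutBdd_pair (hLc : Odd Lc) (N : ℕ) (cΛ cB : ℝ) (cΛ' cB' : ℕ → ℝ) (tabs : ∀ m : ℕ, SymTables 3 (Lc ^ m))
    (cΛ'' cB'' : ℕ → ℝ) {Nc : ℝ} {μ ν : Fin 4}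
    (hbdd : ReadoutBdd Lc (JsB12CombShSym hLc N (symTablesAn1S2 3 Lc cΛ) cΛ cB) (JcOf hLc N cΛ' cB') μ ν)
    (hbdd' : ReadoutBdd Lc (JsB12CombShSym hLc N (symTablesAn1S2 3 Lc cΛ) cΛ cB)
      (fun m => JsB12CombShSym (Lc := Lc ^ m) hLc.pow N (tabs m) (cΛ'' m) (cB'' m) 0) μ ν) :
    OneShotLaw Lc (JcOf hLc N cΛ' cB') Nc μ ν ↔
      OneShotLaw Lc (fun m => JsB12CombShSym (Lc := Lc ^ m) hLc.pow N (tabs m) (cΛ'' m) (cB'' m) 0) Nc μ ν :=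
  oneShotLaw_iff_of_readoutBdd_pair _ _ _ hbdd hbdd'

/-! ## §3 Up to the T⁴ headline: the print-faithful torus theorem with its β-binder replaced by the two named residues -/

section Headline

variable {F : T4Family} {Ncol : ℕ} [NeZero Ncol]

/-- [folklore] **THE T⁴ HEADLINE FROM THE TWO NAMED RESIDUES (∀-form ∧ ∃-form)**: a printed-averaged finite-ε datum `D` on `SU(Ncol)` (B1 `hD`), Bałaban's end statement
(B) (B2 `hB`), the spine slot under endpoint existence (B5 `hNE`, 0/9 proved), a one-loop split `Sβ` of ITS β-family `D.βfun` whose one-loop coefficients ARE the typed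
step kernels' (1.22) second moments (`hβ`), row D1's residue `Residue Lc Js N μ ν` for those step jets, row D4's residue `AtSlope Sβ γ₀ (stepBal N Lc)` on a box
`γ₀ > 0`, and joint continuity (C) on the same box ⟹ `ContinuumYM4Torus D ∧ ContinuumYM4TorusE D`
(`continuumYM4_torus_of_endpointExistence_nonvacuous` ∘ `D1Residue.endpointExistence_of_residue_atSlope`, forward generation = the datum's field `D.fwd`).
B3 (`BetaPertH`), B4, B6 do not appear: they are REPLACED by the residues + (C); CAP + tail do not appear at all.  Every binder a hypothesis; 0 discharged. -/
theorem continuumYM4Torus_of_residue_atSlope (D : FiniteEpsData F (Matrix.specialUnitaryGroup (Fin Ncol) ℂ)) (hD : D.IsPrintedAveraged)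
    (hB : B16.EndStatementBPrinted D.C) (hNE : T4ApexHybrid.HybridNE7Under D (EndpointExistence D.C.toB12))
    (Sβ : B12Beta.OneLoopSplit D.βfun) (Js : ℕ → JetData 3 Lc) {N : ℝ} {μ ν : Fin 4}
    (hβ : ∀ j, Sβ.β0 j = secondMoment (TbalOf Lc Js j) μ ν) (hres : Residue Lc Js N μ ν)
    {γ₀ : ℝ} (hγ₀ : 0 < γ₀) (hslope : AtSlope Sβ γ₀ (B12Normalization.stepBal N Lc)) (hcont : BetaContH γ₀ D.βfun) :
    ContinuumYM4Torus D ∧ ContinuumYM4TorusE D :=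
  continuumYM4_torus_of_endpointExistence_nonvacuous D hD hB
    (endpointExistence_of_residue_atSlope D.fwd Sβ Js hβ hres hγ₀ hslope hcont) hNE

/-- [folklore] **THE T⁴ HEADLINE AT ONE COMPOSITE-CONTOUR FAMILY**: the same with row D1's residue OPENED at a composite-contour family of the (III′) literal of record —
(RB) of the record step jets onto `m ↦ JsB12CombShSym (Lc := Lc^m) hLc.pow Ng (tabs m) (cΛ' m) (cB' m) 0` ∧ that family's one-shot law — and everything else as in
`continuumYM4Torus_of_residue_atSlope`.  The cell's reading of the whole B12-Theorem-2 wall on the L1.2 path in ONE kernel line: B1 ∧ B2 ∧ B5 ∧ `hβ` ∧ (RB) ∧ (OSL) ∧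
AtSlope(D4) ∧ (C) ⟹ headline.  Nothing asserted of the table family; 0 discharged. -/
theorem continuumYM4Torus_of_readoutBdd_oneShotLaw_tabs_atSlope (D : FiniteEpsData F (Matrix.specialUnitaryGroup (Fin Ncol) ℂ))
    (hD : D.IsPrintedAveraged) (hB : B16.EndStatementBPrinted D.C) (hNE : T4ApexHybrid.HybridNE7Under D (EndpointExistence D.C.toB12))
    (Sβ : B12Beta.OneLoopSplit D.βfun) (hLc : Odd Lc) (Ng : ℕ) (cΛ cB : ℝ) (tabs : ∀ m : ℕ, SymTables 3 (Lc ^ m)) (cΛ' cB' : ℕ → ℝ)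
    {N : ℝ} {μ ν : Fin 4} (hβ : ∀ j, Sβ.β0 j = secondMoment (TbalOf Lc (JsB12CombShSym hLc Ng (symTablesAn1S2 3 Lc cΛ) cΛ cB) j) μ ν)
    (hbdd : ReadoutBdd Lc (JsB12CombShSym hLc Ng (symTablesAn1S2 3 Lc cΛ) cΛ cB)
      (fun m => JsB12CombShSym (Lc := Lc ^ m) hLc.pow Ng (tabs m) (cΛ' m) (cB' m) 0) μ ν)
    (hlaw : OneShotLaw Lc (fun m => JsB12CombShSym (Lc := Lc ^ m) hLc.pow Ng (tabs m) (cΛ' m) (cB' m) 0) N μ ν)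
    {γ₀ : ℝ} (hγ₀ : 0 < γ₀) (hslope : AtSlope Sβ γ₀ (B12Normalization.stepBal N Lc)) (hcont : BetaContH γ₀ D.βfun) :
    ContinuumYM4Torus D ∧ ContinuumYM4TorusE D :=
  continuumYM4Torus_of_residue_atSlope D hD hB hNE Sβ _ hβ ⟨_, hbdd, hlaw⟩ hγ₀ hslope hcont

/-- [folklore] **THE T⁴ HEADLINE IN THE Jc-FREE CURRENCY AT THE RECORD LITERAL** (g1-plan-2 SK-D1c): `D1Cum` for the record step coefficients ∧ the two PRINTED [B5]
statements BY NAME (+ labels, `μ ≠ ν`, `N ≠ 0`, `2 ≤ Lc`, `Odd Lc`) in place of row D1's residue (`D1Residue.d1Drift_record_of_d1Cum` then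
`D4Residue.endpointExistence_of_D1Drift_atSlope`), everything else as in `continuumYM4Torus_of_residue_atSlope`.  0 discharged. -/
theorem continuumYM4Torus_of_d1Cum_atSlope_record (D : FiniteEpsData F (Matrix.specialUnitaryGroup (Fin Ncol) ℂ))
    (hD : D.IsPrintedAveraged) (hB : B16.EndStatementBPrinted D.C) (hNE : T4ApexHybrid.HybridNE7Under D (EndpointExistence D.C.toB12))
    (Sβ : B12Beta.OneLoopSplit D.βfun) (hLc : Odd Lc) (hL2 : 2 ≤ Lc) (Ng : ℕ) (cΛ cB : ℝ) (a : ℝ) (ha : 0 < a)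
    (h12 : B5.Prop12Printed (fam (fun i : ℕ+ × ℕ => ((i.1 : ℕ+) : ℕ)) (fun i => i.1.pos) MvE a ha))
    (h126 : B5.Kernel126_127Printed (kfam (fun i : ℕ+ × ℕ => ((i.1 : ℕ+) : ℕ)) MvE))
    {SL : Finset L} (hSL : SL.Nonempty) (k : L → Fin 4) {μ ν : Fin 4} (hμν : μ ≠ ν) {N : ℝ} (hN : N ≠ 0)
    (hβ : ∀ j, Sβ.β0 j = secondMoment (TbalOf Lc (JsB12CombShSym hLc Ng (symTablesAn1S2 3 Lc cΛ) cΛ cB) j) μ ν)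
    (hcum : D1Cum Lc (fun j => secondMoment (TbalOf Lc (JsB12CombShSym hLc Ng (symTablesAn1S2 3 Lc cΛ) cΛ cB) j) μ ν) N μ ν a SL k)
    {γ₀ : ℝ} (hγ₀ : 0 < γ₀) (hslope : AtSlope Sβ γ₀ (B12Normalization.stepBal N Lc)) (hcont : BetaContH γ₀ D.βfun) :
    ContinuumYM4Torus D ∧ ContinuumYM4TorusE D :=
  continuumYM4_torus_of_endpointExistence_nonvacuous D hD hB
    (D4Residue.endpointExistence_of_D1Drift_atSlope D.fwd Sβ _ hβ
      (d1Drift_record_of_d1Cum hLc hL2 Ng cΛ cB a ha h12 h126 hSL k hμν hN hcum) hγ₀ hslope hcont) hNE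

end Headline

end Summit.QuantumFields.BalabanUV.Gaps.D1ResidueComposite

end
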